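import Mathlib

/-!
# PneNP / PositionalGames — glue `ParityToMpg`: arithmetic and combinatorial helpers

Helpers (`--supports stmt-PneNP-1301`) for the monotone projection of parity games into threshold
mean-payoff games (Jurdziński 1998: priority `p` ↦ weight `(-N)^p`; here `N = 2^n` and the
weights are shifted by `2^{m-1}` into `[0, 2^m)`). Nothing in this file mentions circuits:

* §1 lasso cycles: a sequence in a finite type takes some value infinitely often, and the set of
  points visited infinitely often by `F^[t] a₀` is transported along an injection `e` with
  `F' ∘ e = e ∘ F`;
* §2 Jurdziński's sign lemma: on a nonempty finite `C` with `#C ≤ N`, `0 ≤ ∑_{u ∈ C} (-N)^{q u}` iff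
  the largest exponent on `C` is even (the top term dominates);
* §3 binary digits: `∑_{j<m} [bit_j W]·2^j = W` for `W < 2^m`; and the shifted weights
  `2^{m-1} + (-2^n)^q` lie in `[0, 2^m)` once `2n² < m` and `q < 2n`;
* §4 priority compression: priorities on `n` vertices can be replaced by priorities `< 2n` with the
  same parity of the maximum over every nonempty vertex set.
-/

namespace Summit.PneNP.PneNP.Theorems

open Finset Filter

/-! ## §1 Lasso cycles -/

/-- Pigeonhole: a sequence in a finite type takes some value infinitely often. [folklore] -/
theorem ptm_exists_frequently_eq {α : Type*} [Finite α] (g : ℕ → α) :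
    ∃ a, ∃ᶠ t in atTop, g t = a := by
  by_contra h
  have h' : ∀ a, ∀ᶠ t in atTop, g t ≠ a := fun a => not_frequently.1 fun hf => h ⟨a, hf⟩
  obtain ⟨t, ht⟩ := (eventually_all.2 h').exists
  exact ht (g t) rfl

/-- The lasso cycle of `F` from `a₀` — the set of points visited infinitely often by
`t ↦ F^[t] a₀` — is nonempty. [folklore] -/
theorem ptm_cycle_nonempty {α : Type*} [Fintype α] (F : α → α) (a₀ : α)
    [DecidablePred fun a : α => ∃ᶠ t in atTop, F^[t] a₀ = a] :
    (univ.filter fun a : α => ∃ᶠ t in atTop, F^[t] a₀ = a).Nonempty := by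
  obtain ⟨a, ha⟩ := ptm_exists_frequently_eq fun t => F^[t] a₀
  exact ⟨a, mem_filter.2 ⟨mem_univ _, ha⟩⟩

/-- Transport of the lasso cycle along an injection `e` with `F' ∘ e = e ∘ F`: the cycle of `F'`
from `e a₀` is the image of the cycle of `F` from `a₀`. [folklore] -/
theorem ptm_cycle_map {α β : Type*} [Fintype α] [Fintype β] (e : α → β)
    (he : Function.Injective e) {F : α → α} {F' : β → β} (h : ∀ a, F' (e a) = e (F a)) (a₀ : α)
    [DecidablePred fun b : β => ∃ᶠ t in atTop, F'^[t] (e a₀) = b]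
    [DecidablePred fun a : α => ∃ᶠ t in atTop, F^[t] a₀ = a] :
    (univ.filter fun b : β => ∃ᶠ t in atTop, F'^[t] (e a₀) = b) =
      (univ.filter fun a : α => ∃ᶠ t in atTop, F^[t] a₀ = a).map ⟨e, he⟩ := by
  have hsemi : Function.Semiconj e F F' := fun a => (h a).symm
  have key : ∀ t, F'^[t] (e a₀) = e (F^[t] a₀) := fun t => ((hsemi.iterate_right t) a₀).symm
  ext b
  simp only [mem_filter, mem_univ, true_and, Finset.mem_map, Function.Embedding.coeFn_mk]
  constructor
  · intro hb
    obtain ⟨t, ht⟩ := hb.exists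
    refine ⟨F^[t] a₀, ?_, by rw [← key, ht]⟩
    refine hb.mono fun s hs => he ?_
    rw [← key, hs, ← ht, key]
  · rintro ⟨a, ha, rfl⟩
    exact ha.mono fun s hs => by rw [key, hs]

/-! ## §2 Jurdziński's sign lemma -/

/-- **Jurdziński's sign lemma** (the arithmetic behind the reduction of parity games to mean-payoff
games, Jurdziński 1998, Inform. Process. Lett. 68, proof of Thm. 6): on a nonempty finite set `C`
with `#C ≤ N`, the sum `∑_{u ∈ C} (-N)^{q u}` is nonnegative iff the largest exponent `max_C q` is
even — the `≥ 1` terms of top exponent `d` outweigh the at most `#C - 1 < N` terms of exponent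
`< d`, whose total is `< N·N^{d-1}`. [folklore] -/
theorem ptm_sign_iff {α : Type*} (C : Finset α) (hC : C.Nonempty) (q : α → ℕ) (N : ℤ)
    (hN : (C.card : ℤ) ≤ N) :
    (0 ≤ ∑ u ∈ C, (-N) ^ q u) ↔ Even (C.sup q) := by
  classical
  have hN1 : 1 ≤ N := le_trans (by exact_mod_cast hC.card_pos) hN
  have hN0 : 0 ≤ N := zero_le_one.trans hN1
  obtain ⟨u₀, hu₀, hdu₀⟩ := exists_mem_eq_sup C hC q
  set d := C.sup q with hd
  have hle : ∀ u ∈ C, q u ≤ d := fun u hu => le_sup hu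
  -- split off the terms of top exponent
  set A := C.filter fun u => q u = d with hA
  set B := C.filter fun u => ¬ q u = d with hB
  have hsplit : ∑ u ∈ C, (-N) ^ q u = ∑ u ∈ A, (-N) ^ q u + ∑ u ∈ B, (-N) ^ q u :=
    (sum_filter_add_sum_filter_not C (fun u => q u = d) _).symm
  have hsumA : ∑ u ∈ A, (-N) ^ q u = (A.card : ℤ) * (-N) ^ d := by
    rw [sum_congr rfl fun u hu => by rw [(mem_filter.1 hu).2], sum_const, nsmul_eq_mul]
  have hA1 : (1 : ℤ) ≤ A.card := by
    have hu₀A : u₀ ∈ A := mem_filter.2 ⟨hu₀, hdu₀.symm⟩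
    exact_mod_cast card_pos.2 ⟨u₀, hu₀A⟩
  have hBlt : |∑ u ∈ B, (-N) ^ q u| < N ^ d := by
    have hBq : ∀ u ∈ B, q u < d := fun u hu =>
      lt_of_le_of_ne (hle u (mem_filter.1 hu).1) (mem_filter.1 hu).2
    rcases Nat.eq_zero_or_pos d with hd0 | hdpos
    · have hBe : B = ∅ := by
        refine eq_empty_iff_forall_notMem.2 fun u hu => ?_
        have := hBq u hu
        omega
      rw [hBe, sum_empty, abs_zero, hd0, pow_zero]
      exact one_pos
    · calc |∑ u ∈ B, (-N) ^ q u| ≤ ∑ u ∈ B, |(-N) ^ q u| := abs_sum_le_sum_abs _ _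
        _ ≤ ∑ u ∈ B, N ^ (d - 1) := by
          refine sum_le_sum fun u hu => ?_
          rw [abs_pow, abs_neg, abs_of_nonneg hN0]
          exact pow_le_pow_right₀ hN1 (by have := hBq u hu; omega)
        _ = (B.card : ℤ) * N ^ (d - 1) := by rw [sum_const, nsmul_eq_mul]
        _ < N * N ^ (d - 1) := by
          refine mul_lt_mul_of_pos_right ?_ (pow_pos (by omega) _)
          have hBC : B.card < C.card :=
            card_lt_card (filter_ssubset.2 ⟨u₀, hu₀, not_not.2 hdu₀.symm⟩)
          calc (B.card : ℤ) < C.card := by exact_mod_cast hBC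
            _ ≤ N := hN
        _ = N ^ d := by rw [← pow_succ', Nat.sub_add_cancel hdpos]
  rw [hsplit, hsumA]
  rcases Nat.even_or_odd d with hev | hodd
  · rw [hev.neg_pow]
    refine ⟨fun _ => hev, fun _ => ?_⟩
    have h1 : N ^ d ≤ (A.card : ℤ) * N ^ d := le_mul_of_one_le_left (pow_nonneg hN0 _) hA1
    have h2 := (abs_lt.1 hBlt).1
    linarith
  · rw [hodd.neg_pow, mul_neg]
    refine ⟨fun h => ?_, fun h => absurd h (Nat.not_even_iff_odd.2 hodd)⟩
    exfalso
    have h1 : N ^ d ≤ (A.card : ℤ) * N ^ d := le_mul_of_one_le_left (pow_nonneg hN0 _) hA1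
    have h2 := (abs_lt.1 hBlt).2
    linarith

/-! ## §3 Binary digits and the size of the weights -/

/-- Binary expansion below `2^m`: `∑_{j<m} [bit_j W]·2^j = W` for `W < 2^m`. [folklore] -/
theorem ptm_sum_testBit : ∀ {m W : ℕ}, W < 2 ^ m →
    ∑ j : Fin m, (if W.testBit j = true then 2 ^ (j : ℕ) else 0) = W
  | 0, W, hW => by
    have hW0 : W = 0 := by simpa using hW
    subst hW0
    simp
  | m + 1, W, hW => by
    rw [Fin.sum_univ_succ]
    simp only [Fin.val_zero, Fin.val_succ, Nat.testBit_succ, pow_zero, Nat.testBit_zero,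
      decide_eq_true_eq]
    have h2m : 2 ^ (m + 1) = 2 * 2 ^ m := pow_succ' 2 m
    have h2 : W / 2 < 2 ^ m := by omega
    have hsum : ∑ j : Fin m, (if (W / 2).testBit j = true then 2 ^ ((j : ℕ) + 1) else 0) =
        2 * ∑ j : Fin m, (if (W / 2).testBit j = true then 2 ^ (j : ℕ) else 0) := by
      rw [mul_sum]
      refine sum_congr rfl fun j _ => ?_
      split_ifs <;> ring
    rw [hsum, ptm_sum_testBit h2]
    split_ifs <;> omega

/-- The shifted Jurdziński weights fit into `m` bits: for `2n² < m` and `q < 2n`,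
`0 ≤ 2^{m-1} + (-2^n)^q < 2^m` (indeed `|(-2^n)^q| = 2^{nq}` and `nq ≤ 2n² - n < m - 1`).
[folklore] -/
theorem ptm_weight_bounds {n m q : ℕ} (hm : 2 * n ^ 2 < m) (hq : q < 2 * n) :
    (0 : ℤ) ≤ 2 ^ (m - 1) + (-(2 : ℤ) ^ n) ^ q ∧
      (2 : ℤ) ^ (m - 1) + (-(2 : ℤ) ^ n) ^ q < 2 ^ m := by
  have hn : 1 ≤ n := by omega
  have hexp : n * q < m - 1 := by
    have h1 : n * q + n ≤ 2 * n ^ 2 := by nlinarith [Nat.mul_le_mul_left n hq]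
    omega
  have habs : |(-(2 : ℤ) ^ n) ^ q| < 2 ^ (m - 1) := by
    rw [abs_pow, abs_neg, abs_pow, abs_two, ← pow_mul]
    exact pow_lt_pow_right₀ (by norm_num) hexp
  have hm1 : (2 : ℤ) ^ m = 2 ^ (m - 1) + 2 ^ (m - 1) := by
    rw [← two_mul, ← pow_succ']
    congr 1
    omega
  have hlo := neg_abs_le ((-(2 : ℤ) ^ n) ^ q)
  have hhi := le_abs_self ((-(2 : ℤ) ^ n) ^ q)
  constructor
  · linarith
  · linarith

/-! ## §4 Priority compression -/

/-- **Priority compression**: any priority map `p` on `n` vertices can be replaced by one with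
values `< 2n` that is order-equivalent to `p` and has the same parities (`q u = 2·#{p w < p u} +
(p u mod 2)`, counting distinct values). [folklore] -/
theorem ptm_compress {n : ℕ} (p : Fin n → ℕ) :
    ∃ q : Fin n → ℕ, (∀ u, q u < 2 * n) ∧ (∀ u w, q u ≤ q w ↔ p u ≤ p w) ∧
      ∀ u, Even (q u) ↔ Even (p u) := by
  classical
  set V := (univ : Finset (Fin n)).image p with hV
  set r : Fin n → ℕ := fun u => (V.filter fun a => a < p u).card with hr
  have hr_lt : ∀ u w, p u < p w → r u < r w := by
    intro u w huw
    apply card_lt_card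
    refine (ssubset_iff_of_subset (monotone_filter_right V fun a _ ha => ha.trans huw)).2 ?_
    exact ⟨p u, mem_filter.2 ⟨mem_image_of_mem p (mem_univ u), huw⟩,
      fun h => lt_irrefl _ (mem_filter.1 h).2⟩
  have hr_bound : ∀ u, r u + 1 ≤ n := by
    intro u
    have h1 : r u < V.card :=
      card_lt_card (filter_ssubset.2 ⟨p u, mem_image_of_mem p (mem_univ u), lt_irrefl _⟩)
    have h2 : V.card ≤ n := card_image_le.trans (by simp)
    omega
  refine ⟨fun u => 2 * r u + p u % 2, fun u => ?_, fun u w => ?_, fun u => ?_⟩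
  · dsimp only
    have := hr_bound u
    have := Nat.mod_lt (p u) two_pos
    omega
  · dsimp only
    constructor
    · intro h
      by_contra hlt
      have hlt' : p w < p u := not_le.1 hlt
      have := hr_lt w u hlt'
      have := Nat.mod_lt (p w) two_pos
      have := Nat.mod_lt (p u) two_pos
      omega
    · intro h
      rcases h.lt_or_eq with hlt | heq
      · have := hr_lt u w hlt
        have := Nat.mod_lt (p u) two_pos
        omega
      · have hre : r u = r w := by simp only [hr, heq]
        simp only [hre, heq, le_refl]
  · dsimp only
    rw [Nat.even_iff, Nat.even_iff]
    omega

/-- With compressed priorities the parity of the maximum over any nonempty vertex set is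
unchanged. [folklore] -/
theorem ptm_even_sup_iff {n : ℕ} {p q : Fin n → ℕ} (hpq : ∀ u w, q u ≤ q w ↔ p u ≤ p w)
    (hev : ∀ u, Even (q u) ↔ Even (p u)) (C : Finset (Fin n)) (hC : C.Nonempty) :
    Even (C.sup q) ↔ Even (C.sup p) := by
  obtain ⟨u₀, hu₀, h₀⟩ := exists_mem_eq_sup C hC p
  have hq : C.sup q = q u₀ :=
    le_antisymm (Finset.sup_le fun u hu => (hpq u u₀).2 ((le_sup hu).trans h₀.le)) (le_sup hu₀)
  rw [hq, h₀]
  exact hev u₀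

end Summit.PneNP.PneNP.Theorems
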